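import Literature.Algebra.EuclideanLattices.KhotGapInstancesParam
import Literature.InformationTheory.Coding.BCHExplicit
import HarnessLib

/-!
# Khot 2005, Thm. 1.1 (constant factors, `p = 2`): the gap-instance theorem with the EXPLICIT BCH block

Topic `Algebra/EuclideanLattices`, namespace `Literature.Algebra.EuclideanLattices.Khot`. A small
brick of the decomposition of `Literature.Algebra.EuclideanLattices.gapSVP_const_isNPHardRandomized`
(pqc.S17) through `Khot2005_SAT_randReducible_gapSVP` (`KhotSVPHardness.lean`), between the
parametrised gap-instance theorem `khot_gap_instances_of` (`KhotGapInstancesParam.lean`: ANY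
`{0,1}`-matrix `P` with `40K`-wise independent columns) and the machine level: it fixes `P` to the
one explicit matrix a machine computes, `khotBCH u σ K k := bchExplicit (20K) M N`
(`InformationTheory/Coding/BCHExplicit.lean`: the binary BCH parity-check matrix over
`GF(2^{M+1}) = 𝔽₂[X]/(f_M)`, `f_M` the least-bitmask irreducible polynomial of degree `M + 1`,
locators the elements with bitmasks `1, …, N`; entry formula `bchExplicit_apply`), for Khot's
parameters `t = 20K`, `M = MM u σ K k`, `N = NN u σ K k = 2^M` (`Params`, `KhotParameters.lean`),
and discharges the two hypotheses `hP01`, `hDW` of `khot_gap_instances_of` for it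
(`khotBCH_entry`, `khotBCH_dwise`, from `bchExplicit_spec` with `N + 1 ≤ 2^{M+1}`), giving
`khot_gap_instances_bch`: the YES/NO error counts for the explicit `P`, with only the output
enumerations `eR`, `eC` (the machine's emission order) and the number of levels `k` left as data.
All proved; no facts.

## References

* S. Khot, *Hardness of approximating the shortest vector problem in lattices*, J. ACM 52 (2005)
  789–808, Thm. 1.1, Thm. 4.1 ("The parity check matrix for BCH codes has this property and it can
  be constructed efficiently"), Thm. 5.1, §7.3.
* R. J. McEliece, *The Theory of Information and Coding*, 2nd ed., CUP 2002, Ch. 9 §9.1.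
-/

noncomputable section

namespace Literature.Algebra.EuclideanLattices.Khot

open Matrix Finset Params
open Literature.InformationTheory.Coding (bchExplicit bchExplicit_entry bchExplicit_spec)

/-! ### Khot's BCH block, explicitly -/

/-- **Khot's BCH block `P_BCH` for the explicit parameters** (Thm. 4.1 with `d = 40K`,
`h = (d/2)·(M+1)` rows, `N = 2^M` columns): the explicit binary BCH parity-check matrix
`bchExplicit (20K) M N` of `BCHExplicit.lean`. [cite: Khot2005, Thm. 4.1] -/
def khotBCH (u σ K k : ℕ) : Matrix (Fin (20 * K) × Fin (MM u σ K k + 1)) (Fin (NN u σ K k)) ℤ :=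
  bchExplicit (20 * K) (MM u σ K k) (NN u σ K k)

/-- `N + 1 ≤ 2^{M+1}` for `N = 2^M`: the `N` nonzero locators fit. [folklore] -/
theorem NN_succ_le (u σ K k : ℕ) : NN u σ K k + 1 ≤ 2 ^ (MM u σ K k + 1) := by
  unfold NN
  rw [pow_succ]
  have := Nat.one_le_two_pow (n := MM u σ K k)
  omega

/-- The entries of `khotBCH` are `0` or `1` (hypothesis `hP01` of `khot_gap_instances_of`).
[cite: Khot2005, Thm. 4.1] -/
theorem khotBCH_entry (u σ K k : ℕ) :
    ∀ r i, khotBCH u σ K k r i = 0 ∨ khotBCH u σ K k r i = 1 :=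
  bchExplicit_entry _ _ _

/-- **Any `40K` columns of `khotBCH` are independent over `GF(2)`** (`DWise`, hypothesis `hDW` of
`khot_gap_instances_of`), by `bchExplicit_spec`. [cite: Khot2005, Thm. 4.1] -/
theorem khotBCH_dwise (u σ K k : ℕ) : DWise (khotBCH u σ K k) (40 * K) := fun z hodd hcard =>
  (bchExplicit_spec (20 * K) (MM u σ K k) (NN u σ K k) (NN_succ_le u σ K k)).2 z hodd
    (hcard.trans (le_of_eq (by ring)))

/-! ### The gap-instance theorem for the explicit `P` -/

open Classical in
/-- **Khot 2005, Thm. 1.1 (first assertion), Euclidean norm, with the explicit BCH block.** The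
statement of `khot_gap_instances_of` (`KhotGapInstancesParam.lean`) for `P := khotBCH u σ K k`:
for `γ₀ ≥ 1`, `k` with `8γ₀² < (8/7)^k`, a set system `F` on a universe of size `u ≥ 1` with `σ`
sets, `K ≥ 1`, and ANY output enumerations `eR`, `eC`, over `Ω = (Fin 31K → Fin N) × (rows → ℤ/q)`:
(YES) an exact cover by `K` sets ⇒ at most `2/100` of `Ω` gives an instance outside `GapSVP.yes`;
(NO) no cover by `< 40K` sets ⇒ at most `1/100` of `Ω` gives an instance outside `GapSVP.no γ₀`.
[cite: Khot2005, Thm. 1.1 and §7.3] -/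
theorem khot_gap_instances_bch (γ₀ : ℝ) (hγ₀ : 1 ≤ γ₀) (k : ℕ) (hk : 8 * γ₀ ^ 2 < (8 / 7 : ℝ) ^ k)
    (u σ K : ℕ) (hu : 1 ≤ u) (hK : 1 ≤ K) (F : Fin σ → Finset (Fin u)) (Nf : ℕ)
    (eR : Out (RowsT u σ K k ⊕ Unit) (ColsT u σ K k) k ≃ Fin Nf)
    (eC : (Coef (ColsT u σ K k) k ⊕ {o // augPad (n := ColsT u σ K k)
      (basePad (S := Fin σ) (H := Fin (20 * K) × Fin (MM u σ K k + 1)) (Nn := Fin (NN u σ K k))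
        (⟨0, hu⟩ : Fin u)) k o}) ≃ Fin Nf) :
    ((∃ T₀ : Finset (Fin σ), T₀.card = K ∧ ∀ e : Fin u, (T₀.filter fun j => e ∈ F j).card = 1) →
      100 * #((univ : Finset ((Fin (31 * K) → Fin (NN u σ K k)) × (RowsT u σ K k → ZMod (qq u σ K k)))).filter
          fun ω => khotInstance (DD u σ K k : ℤ) F (khotBCH u σ K k) (tupleShift (khotBCH u σ K k) ω.1)
            (DD u σ K k : ℤ) (qq u σ K k) (⟨0, hu⟩ : Fin u) ((ss u σ K k ^ k : ℕ) : ℤ) k (DD u σ K k : ℤ)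
            (tauN u σ K k : ℚ) eR eC ω.2 ∉ GapSVP.yes fun _ => γ₀) ≤
        2 * (Fintype.card (Fin (NN u σ K k)) ^ (31 * K) * qq u σ K k ^ Fintype.card (RowsT u σ K k))) ∧
    ((∀ T₀ : Finset (Fin σ), T₀.card < 40 * K → ∃ e : Fin u, ∀ j ∈ T₀, e ∉ F j) →
      100 * #((univ : Finset ((Fin (31 * K) → Fin (NN u σ K k)) × (RowsT u σ K k → ZMod (qq u σ K k)))).filter
          fun ω => khotInstance (DD u σ K k : ℤ) F (khotBCH u σ K k) (tupleShift (khotBCH u σ K k) ω.1)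
            (DD u σ K k : ℤ) (qq u σ K k) (⟨0, hu⟩ : Fin u) ((ss u σ K k ^ k : ℕ) : ℤ) k (DD u σ K k : ℤ)
            (tauN u σ K k : ℚ) eR eC ω.2 ∉ GapSVP.no fun _ => γ₀) ≤
        Fintype.card (Fin (NN u σ K k)) ^ (31 * K) * qq u σ K k ^ Fintype.card (RowsT u σ K k)) :=
  khot_gap_instances_of γ₀ hγ₀ k hk u σ K hu hK F (khotBCH u σ K k) (khotBCH_entry u σ K k)
    (khotBCH_dwise u σ K k) Nf eR eC

end Literature.Algebra.EuclideanLattices.Khot
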